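import Literature.Computability.Cryptography.PeriodFindingClassWindowLaw
import HarnessLib

/-!
# The window law of a jittered class sum, II: near-uniformity of the read dual vector

Topic `Computability/Cryptography` (harmonic analysis of period finding over `ℤ^T`); theorem-only file, no named facts.
Sequel of `PeriodFindingClassWindowLaw.lean` (same setting and notation: class table `cls` of `Λ ≤ ℤ^T`, `h = [ℤ^T:Λ] ≤ hB`,
one class `A`, base angles `x`, unimodular jitter `ψ` with `|ψ − 1| ≤ ερ`, jittered class sum `Z(ν)`, balls of radius
`2u/M` around the dual vectors, `α = hB²T/M`, `ε' = T/(u−2) + 2hB²(2u)^T/M`).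

* `class_ball_mass_le` — for every dual vector `ζ₀ ∈ ([0,1) ∩ ℚ)^T` of `Λ`:
  `8h · ∑_{ν accurate for ζ₀} |Z(ν)|² ≤ 9 · ∑_{ν accurate for some ζ} |Z(ν)|²` provided
  `8hB·(hB α) + 8hB·ε' + 16hB(1+α)ερ ≤ 1`. So, given the class (and whatever the nonnegative weight the class carries),
  the dual vector read from an accurate frequency is pointwise `(1 + 1/8)/h`-near-uniform on `Λ^*/ℤ^T`.

Proof: the ball of `ζ₀` is disjoint from the windows of the `≥ h − 1` characters `χ` with `ξ_χ ≠ ζ₀`; those windows are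
accurate and carry unjittered energy `≥ (h−1)(M^{2T}/h²)(1−ε')`, jitter costs `≤ 2M^T#A ερ`, and everything together is
at most the total `M^T #A ≤ (M^{2T}/h)(1+α)` — so the ball of `ζ₀` holds at most about `1/h` of the accurate mass.

## References

* S. Hallgren, STOC 2005, §4. [Hallgren2005]
* A. Yu. Kitaev, arXiv:quant-ph/9511026 (1995), §4. [Kitaev1995]
-/

noncomputable section

namespace Literature.Computability.Cryptography

namespace PeriodFinding

open Complex Finset
open scoped Classical

/-- **Near-uniformity of the read dual vector (ball law of a jittered class sum).** In the setting of
`class_offBall_mass_le`, for every dual vector `ζ₀` of `[0,1)^T` pairing integrally with `Λ`, if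
`8hB²·hB T/M + 8hB(T/(u−2) + 2hB²(2u)^T/M) + 16hB(1 + hB²T/M)ερ ≤ 1` then
`8[ℤ^T:Λ] · ∑_{ν ∈ ball(ζ₀)} |Z(ν)|² ≤ 9 · ∑_{ν ∈ some ball} |Z(ν)|²`. [cite: Hallgren2005, §4] -/
theorem class_ball_mass_le : ∀ {T : ℕ}, 0 < T → ∀ {M : ℕ}, 0 < M → ∀ (Λ : AddSubgroup (Fin T → ℤ)) [Λ.FiniteIndex]
    {hB : ℕ}, Λ.index ≤ hB → ∀ (cls : ℕ → ℕ), (∀ E < M ^ T, ∀ E' < M ^ T, cls E = cls E' ↔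
      (fun t : Fin T => ((E / M ^ (t : ℕ) % M : ℕ) : ℤ) - ((E' / M ^ (t : ℕ) % M : ℕ) : ℤ)) ∈ Λ) →
    ∀ {E₀ : ℕ}, E₀ < M ^ T → ∀ (x : Fin T → ℝ) (ψ : ℕ → ℂ) {ερ : ℝ}, 0 ≤ ερ →
    (∀ E < M ^ T, cls E = cls E₀ → ‖ψ E‖ = 1 ∧ ‖ψ E - 1‖ ≤ ερ) →
    ∀ {u : ℕ}, 3 ≤ u → (u : ℝ) / M ≤ 1 / (4 * hB) →
    8 * ((hB : ℝ) ^ 3 * T / M) + 8 * (hB * ((T : ℝ) / (u - 2) + 2 * (hB : ℝ) ^ 2 * (2 * u) ^ T / M)) +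
      16 * hB * (1 + (hB : ℝ) ^ 2 * T / M) * ερ ≤ 1 →
    ∀ (ζ₀ : Fin T → ℚ), (∀ t, 0 ≤ ζ₀ t ∧ ζ₀ t < 1) → (∀ v ∈ Λ, ∃ z : ℤ, ∑ t, ζ₀ t * (v t : ℚ) = z) →
    8 * (Λ.index : ℝ) * ∑ ν ∈ (Finset.range (M ^ T)).filter (fun ν : ℕ =>
        ∀ t : Fin T, |x t + (ζ₀ t : ℝ) + (ν : ℝ) / (M : ℝ) ^ (T - (t : ℕ)) -
          round (x t + (ζ₀ t : ℝ) + (ν : ℝ) / (M : ℝ) ^ (T - (t : ℕ)))| ≤ 2 * (u : ℝ) / M),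
      ‖∑ E ∈ (Finset.range (M ^ T)).filter (fun E => cls E = cls E₀),
        eR (fun t => x t + (ν : ℝ) / (M : ℝ) ^ (T - (t : ℕ))) (toZ fun t : Fin T => E / M ^ (t : ℕ) % M) * ψ E‖ ^ 2 ≤
    9 * ∑ ν ∈ (Finset.range (M ^ T)).filter (fun ν : ℕ => ∃ ζ : Fin T → ℚ, ((∀ t, 0 ≤ ζ t ∧ ζ t < 1) ∧
        ∀ v ∈ Λ, ∃ z : ℤ, ∑ t, ζ t * (v t : ℚ) = z) ∧
        ∀ t : Fin T, |x t + (ζ t : ℝ) + (ν : ℝ) / (M : ℝ) ^ (T - (t : ℕ)) -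
          round (x t + (ζ t : ℝ) + (ν : ℝ) / (M : ℝ) ^ (T - (t : ℕ)))| ≤ 2 * (u : ℝ) / M),
      ‖∑ E ∈ (Finset.range (M ^ T)).filter (fun E => cls E = cls E₀),
        eR (fun t => x t + (ν : ℝ) / (M : ℝ) ^ (T - (t : ℕ))) (toZ fun t : Fin T => E / M ^ (t : ℕ) % M) * ψ E‖ ^ 2 := by
  intro T hT M hM Λ _ hB hhB cls hcls E₀ hE₀ x ψ ερ hερ hψ u hu huM hnum ζ₀ hζ01 hζint
  letI := Λ.fintypeQuotientOfFiniteIndex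
  obtain ⟨hMh, huM', h3u⟩ := law_side_conditions hM Λ hhB hu huM
  have hcard : Fintype.card ((Fin T → ℤ) ⧸ Λ) = Λ.index := by
    rw [AddSubgroup.index_eq_card, Nat.card_eq_fintype_card]
  have hidx : 0 < Λ.index := Nat.pos_of_ne_zero AddSubgroup.FiniteIndex.index_ne_zero
  have hhR : (0 : ℝ) < Λ.index := by exact_mod_cast hidx
  have hh1 : (1 : ℝ) ≤ Λ.index := by exact_mod_cast hidx
  have hhBR : (Λ.index : ℝ) ≤ hB := by exact_mod_cast hhB
  have hMR : (0 : ℝ) < M := by exact_mod_cast hM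
  have hu2 : (0 : ℝ) < (u : ℝ) - 2 := by
    have : (3 : ℝ) ≤ u := by exact_mod_cast hu
    linarith
  obtain ⟨ξ, hξ01, hξchar, hξint, hξinj⟩ := exists_dualAngles Λ
  -- abbreviations
  set W : ℕ := M ^ T with hW
  set A := (range W).filter (fun E => cls E = cls E₀) with hA
  set Z : ℕ → ℂ := fun ν => ∑ E ∈ A,
    eR (fun t => x t + (ν : ℝ) / (M : ℝ) ^ (T - (t : ℕ))) (toZ fun t : Fin T => E / M ^ (t : ℕ) % M) * ψ E with hZ
  set Z0 : ℕ → ℂ := fun ν => ∑ E ∈ A,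
    eR (fun t => x t + (ν : ℝ) / (M : ℝ) ^ (T - (t : ℕ))) (toZ fun t : Fin T => E / M ^ (t : ℕ) % M) with hZ0
  set AccP : ℕ → Prop := fun ν : ℕ => ∃ ζ : Fin T → ℚ, ((∀ t, 0 ≤ ζ t ∧ ζ t < 1) ∧
        ∀ v ∈ Λ, ∃ z : ℤ, ∑ t, ζ t * (v t : ℚ) = z) ∧
        ∀ t : Fin T, |x t + (ζ t : ℝ) + (ν : ℝ) / (M : ℝ) ^ (T - (t : ℕ)) -
          round (x t + (ζ t : ℝ) + (ν : ℝ) / (M : ℝ) ^ (T - (t : ℕ)))| ≤ 2 * (u : ℝ) / M with hAccP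
  set BallP : ℕ → Prop := fun ν : ℕ => ∀ t : Fin T, |x t + (ζ₀ t : ℝ) + (ν : ℝ) / (M : ℝ) ^ (T - (t : ℕ)) -
          round (x t + (ζ₀ t : ℝ) + (ν : ℝ) / (M : ℝ) ^ (T - (t : ℕ)))| ≤ 2 * (u : ℝ) / M with hBallP
  set X : Finset (AddChar ((Fin T → ℤ) ⧸ Λ) ℂ) := univ.filter (fun χ => ¬ ξ χ = ζ₀) with hX
  set WinX : ℕ → Prop := fun ν : ℕ => ∃ χ ∈ X, ∀ t : Fin T, (M : ℝ) *
      min (Int.fract (x t + (ξ χ t : ℝ) + (ν : ℝ) / (M : ℝ) ^ (T - (t : ℕ))))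
        (1 - Int.fract (x t + (ξ χ t : ℝ) + (ν : ℝ) / (M : ℝ) ^ (T - (t : ℕ)))) < u with hWinX
  -- the ball of `ζ₀` and the windows of `X` are accurate, and disjoint
  have hBallAcc : ∀ ν, BallP ν → AccP ν := fun ν hb => ⟨ζ₀, ⟨hζ01, hζint⟩, hb⟩
  have hWinAcc : ∀ ν, WinX ν → AccP ν := by
    rintro ν ⟨χ, -, hw⟩
    refine ⟨ξ χ, ⟨hξ01 χ, hξint χ⟩, fun t => ?_⟩
    have h1 := abs_sub_round_lt_of_window hM (hw t)
    have h2 : (u : ℝ) / M ≤ 2 * (u : ℝ) / M := by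
      rw [mul_div_assoc]; linarith [show (0 : ℝ) ≤ (u : ℝ) / M by positivity]
    exact le_of_lt (h1.trans_le h2)
  have hdisj : Disjoint ((range W).filter (fun ν => BallP ν)) ((range W).filter (fun ν => WinX ν)) := by
    refine disjoint_left.2 fun ν hν hν' => ?_
    obtain ⟨-, hb⟩ := mem_filter.1 hν
    obtain ⟨-, χ, hχX, hw⟩ := mem_filter.1 hν'
    have hb' : ∀ t : Fin T, |(x t + (ν : ℝ) / (M : ℝ) ^ (T - (t : ℕ))) + (ζ₀ t : ℝ) -
        round ((x t + (ν : ℝ) / (M : ℝ) ^ (T - (t : ℕ))) + (ζ₀ t : ℝ))| ≤ 2 * (u : ℝ) / M := by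
      intro t
      have := hb t
      rwa [show x t + (ζ₀ t : ℝ) + (ν : ℝ) / (M : ℝ) ^ (T - (t : ℕ)) =
        (x t + (ν : ℝ) / (M : ℝ) ^ (T - (t : ℕ))) + (ζ₀ t : ℝ) by ring] at this
    have hw' : ∀ t : Fin T, |(x t + (ν : ℝ) / (M : ℝ) ^ (T - (t : ℕ))) + (ξ χ t : ℝ) -
        round ((x t + (ν : ℝ) / (M : ℝ) ^ (T - (t : ℕ))) + (ξ χ t : ℝ))| < (u : ℝ) / M := by
      intro t
      have := abs_sub_round_lt_of_window hM (hw t)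
      rwa [show x t + (ξ χ t : ℝ) + (ν : ℝ) / (M : ℝ) ^ (T - (t : ℕ)) =
        (x t + (ν : ℝ) / (M : ℝ) ^ (T - (t : ℕ))) + (ξ χ t : ℝ) by ring] at this
    have heq := dual_eq_of_ball_of_window Λ h3u ζ₀ (ξ χ) hζ01 (hξ01 χ) hζint (hξint χ) _ hb' hw'
    exact (mem_filter.1 hχX).2 heq.symm
  -- masses
  set m := ∑ ν ∈ (range W).filter (fun ν => BallP ν), ‖Z ν‖ ^ 2 with hm
  set tX := ∑ ν ∈ (range W).filter (fun ν => WinX ν), ‖Z ν‖ ^ 2 with htX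
  have hm0 : 0 ≤ m := sum_nonneg fun _ _ => by positivity
  have ht0 : 0 ≤ tX := sum_nonneg fun _ _ => by positivity
  have hmt_acc : m + tX ≤ ∑ ν ∈ (range W).filter (fun ν => AccP ν), ‖Z ν‖ ^ 2 := by
    rw [hm, htX, ← sum_union hdisj]
    refine sum_le_sum_of_subset_of_nonneg (union_subset ?_ ?_) fun _ _ _ => by positivity
    · intro ν hν
      exact mem_filter.2 ⟨(mem_filter.1 hν).1, hBallAcc ν (mem_filter.1 hν).2⟩
    · intro ν hν
      exact mem_filter.2 ⟨(mem_filter.1 hν).1, hWinAcc ν (mem_filter.1 hν).2⟩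
  have htot : ∑ ν ∈ range W, ‖Z ν‖ ^ 2 = (W : ℝ) * A.card := by
    have := classSum_total hM cls x ψ hψ
    simpa only [hW, Nat.cast_pow] using this
  have hmt_tot : m + tX ≤ (W : ℝ) * A.card := by
    rw [hm, htX, ← sum_union hdisj, ← htot]
    exact sum_le_sum_of_subset_of_nonneg (union_subset (filter_subset _ _) (filter_subset _ _))
      fun _ _ _ => by positivity
  have hN : (A.card : ℝ) ≤ (M : ℝ) ^ T / Λ.index * (1 + (Λ.index : ℝ) ^ 2 * T / M) :=
    card_class_le_real hT hM Λ hMh cls hcls hE₀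
  -- the windows of `X`
  have hwin : (X.card : ℝ) * (((M : ℝ) ^ (2 * T) / (Λ.index : ℝ) ^ 2) *
      (1 - (T : ℝ) / (u - 2) - 2 * (Λ.index : ℝ) ^ 2 * (2 * u) ^ T / M)) ≤
      ∑ ν ∈ (range W).filter (fun ν => WinX ν), ‖Z0 ν‖ ^ 2 :=
    classSum_windows_ge hT hM Λ hhB cls hcls hE₀ x hu huM ξ hξ01 hξchar hξint hξinj X
  have hpert : ∑ ν ∈ (range W).filter (fun ν => WinX ν), ‖Z0 ν‖ ^ 2 ≤ tX + 2 * (M : ℝ) ^ T * A.card * ερ :=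
    classSum_unperturbed_le hM x A (filter_subset _ _) ψ hερ
      (fun E hE => (hψ E (mem_range.1 (mem_filter.1 hE).1) (mem_filter.1 hE).2).2) _ (filter_subset _ _)
  have hXcard : (Λ.index : ℝ) - 1 ≤ X.card := by
    have h1 : (univ.filter (fun χ : AddChar ((Fin T → ℤ) ⧸ Λ) ℂ => ξ χ = ζ₀)).card ≤ 1 :=
      card_le_one.2 fun χ hχ χ' hχ' => hξinj (((mem_filter.1 hχ).2).trans ((mem_filter.1 hχ').2).symm)
    have h2 := Finset.card_filter_add_card_filter_not (s := (univ : Finset (AddChar ((Fin T → ℤ) ⧸ Λ) ℂ)))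
      (fun χ => ξ χ = ζ₀)
    rw [card_univ, AddChar.card_eq, hcard] at h2
    have h3 : Λ.index ≤ X.card + 1 := by rw [hX]; omega
    have : (Λ.index : ℝ) ≤ X.card + 1 := by exact_mod_cast h3
    linarith
  -- numerics: `α_h, ε'_h` and their monotonicity in `h ≤ hB`
  set αh : ℝ := (Λ.index : ℝ) ^ 2 * T / M with hαh
  set εh : ℝ := (T : ℝ) / (u - 2) + 2 * (Λ.index : ℝ) ^ 2 * (2 * u) ^ T / M with hεh
  have hαh0 : 0 ≤ αh := by positivity
  have hεh0 : 0 ≤ εh := by positivity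
  have hC : 8 * (Λ.index * αh) + 8 * (Λ.index * εh) + 16 * Λ.index * (1 + αh) * ερ ≤ 1 := by
    have h1 : (Λ.index : ℝ) * αh ≤ (hB : ℝ) ^ 3 * T / M := by
      rw [hαh, show (hB : ℝ) ^ 3 * T / M = hB * ((hB : ℝ) ^ 2 * T / M) by ring]
      gcongr
    have h2 : (Λ.index : ℝ) * εh ≤ hB * ((T : ℝ) / (u - 2) + 2 * (hB : ℝ) ^ 2 * (2 * u) ^ T / M) := by
      rw [hεh]; gcongr
    have h3 : (Λ.index : ℝ) * (1 + αh) * ερ ≤ hB * (1 + (hB : ℝ) ^ 2 * T / M) * ερ := by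
      rw [hαh]; gcongr
    linarith
  have hε1 : 0 ≤ 1 - εh := by
    have p0 : εh ≤ Λ.index * εh := le_mul_of_one_le_left hεh0 hh1
    have p1 : 0 ≤ (Λ.index : ℝ) * αh := by positivity
    have p2 : 0 ≤ 16 * (Λ.index : ℝ) * (1 + αh) * ερ := by positivity
    linarith
  set P : ℝ := (M : ℝ) ^ (2 * T) / Λ.index with hP
  have hP0 : 0 < P := by positivity
  have hM2T : (M : ℝ) ^ (2 * T) = (M : ℝ) ^ T * (M : ℝ) ^ T := by rw [two_mul, pow_add]
  have hWR : (W : ℝ) = (M : ℝ) ^ T := by rw [hW, Nat.cast_pow]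
  -- `W N ≤ P (1 + α_h)`
  have hWN : (W : ℝ) * A.card ≤ P * (1 + αh) := by
    rw [hWR, hP, hM2T, hαh]
    calc (M : ℝ) ^ T * A.card ≤ (M : ℝ) ^ T * ((M : ℝ) ^ T / Λ.index * (1 + (Λ.index : ℝ) ^ 2 * T / M)) := by gcongr
      _ = _ := by ring
  -- `tX ≥ (h−1)(P/h)(1−ε_h) − 2 P (1+α_h) ερ`
  have hB_eq : (M : ℝ) ^ (2 * T) / (Λ.index : ℝ) ^ 2 = P / Λ.index := by rw [hP]; field_simp
  have htlow : (Λ.index - 1) * (P / Λ.index) * (1 - εh) - 2 * (P * (1 + αh)) * ερ ≤ tX := by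
    set S0 := ∑ ν ∈ (range W).filter (fun ν => WinX ν), ‖Z0 ν‖ ^ 2 with hS0
    have h1 : ((Λ.index : ℝ) - 1) * (P / Λ.index * (1 - εh)) ≤ (X.card : ℝ) * (P / Λ.index * (1 - εh)) :=
      mul_le_mul_of_nonneg_right hXcard (by positivity)
    rw [hB_eq] at hwin
    have h2 : 2 * (M : ℝ) ^ T * A.card * ερ ≤ 2 * (P * (1 + αh)) * ερ := by
      rw [← hWR]
      have : (W : ℝ) * A.card * ερ ≤ P * (1 + αh) * ερ := mul_le_mul_of_nonneg_right hWN hερ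
      linarith
    have h3 : (1 - (T : ℝ) / (u - 2) - 2 * (Λ.index : ℝ) ^ 2 * (2 * u) ^ T / M) = 1 - εh := by rw [hεh]; ring
    rw [h3] at hwin
    have h4 : ((Λ.index : ℝ) - 1) * (P / Λ.index) * (1 - εh) = ((Λ.index : ℝ) - 1) * (P / Λ.index * (1 - εh)) := by
      ring
    rw [h4]
    linarith
  -- the target through `m + tX ≤ accurate mass`
  suffices hmain : 8 * (Λ.index : ℝ) * m ≤ 9 * (m + tX) by
    calc 8 * (Λ.index : ℝ) * m ≤ 9 * (m + tX) := hmain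
      _ ≤ _ := by gcongr
  rcases eq_or_lt_of_le (Nat.succ_le_of_lt hidx) with h1 | h2
  · -- `h = 1`
    have : (Λ.index : ℝ) = 1 := by exact_mod_cast h1.symm
    rw [this]; linarith
  · -- `h ≥ 2`: `(8h − 9) m ≤ (8h−9)(Tot − tX)` and `(8h − 9) Tot ≤ 8h · tlow ≤ 8h · tX`
    have hh2 : (2 : ℝ) ≤ Λ.index := by exact_mod_cast h2
    have hmle : m ≤ P * (1 + αh) - tX := by linarith
    have hk1 : (8 * (Λ.index : ℝ) - 9) * m ≤ (8 * (Λ.index : ℝ) - 9) * (P * (1 + αh) - tX) :=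
      mul_le_mul_of_nonneg_left hmle (by linarith)
    have hbr : (8 * (Λ.index : ℝ) - 9) * (1 + αh) - 8 * (Λ.index - 1) * (1 - εh) + 16 * Λ.index * (1 + αh) * ερ ≤ 0 := by
      have e : (8 * (Λ.index : ℝ) - 9) * (1 + αh) - 8 * (Λ.index - 1) * (1 - εh) + 16 * Λ.index * (1 + αh) * ερ =
          (8 * (Λ.index * αh) + 8 * (Λ.index * εh) + 16 * Λ.index * (1 + αh) * ερ) - 1 - 9 * αh - 8 * εh := by ring
      rw [e]
      linarith
    have hk2 : (8 * (Λ.index : ℝ) - 9) * (P * (1 + αh)) ≤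
        8 * Λ.index * ((Λ.index - 1) * (P / Λ.index) * (1 - εh) - 2 * (P * (1 + αh)) * ερ) := by
      have e : 8 * (Λ.index : ℝ) * ((Λ.index - 1) * (P / Λ.index) * (1 - εh) - 2 * (P * (1 + αh)) * ερ) -
          (8 * (Λ.index : ℝ) - 9) * (P * (1 + αh)) =
          P * (-((8 * (Λ.index : ℝ) - 9) * (1 + αh) - 8 * (Λ.index - 1) * (1 - εh) + 16 * Λ.index * (1 + αh) * ερ)) := by
        field_simp
        ring
      have : 0 ≤ P * (-((8 * (Λ.index : ℝ) - 9) * (1 + αh) - 8 * (Λ.index - 1) * (1 - εh) +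
          16 * Λ.index * (1 + αh) * ερ)) := mul_nonneg hP0.le (by linarith)
      linarith
    have hk3 : 8 * (Λ.index : ℝ) * ((Λ.index - 1) * (P / Λ.index) * (1 - εh) - 2 * (P * (1 + αh)) * ερ) ≤
        8 * Λ.index * tX := mul_le_mul_of_nonneg_left htlow (by positivity)
    have hk4 : (8 * (Λ.index : ℝ) - 9) * m ≤ 9 * tX := by
      have e1 : (8 * (Λ.index : ℝ) - 9) * (P * (1 + αh) - tX) =
          (8 * (Λ.index : ℝ) - 9) * (P * (1 + αh)) - 8 * Λ.index * tX + 9 * tX := by ring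
      rw [e1] at hk1
      linarith
    have e2 : 8 * (Λ.index : ℝ) * m = (8 * (Λ.index : ℝ) - 9) * m + 9 * m := by ring
    rw [e2]
    linarith

end PeriodFinding

end Literature.Computability.Cryptography
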